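import Summits.HodgeConjecture.CorCM.IrreducibleOddWeightsProductSpan
import Summits.HodgeConjecture.CorCM.PointwiseConjugationCMFieldsHodge
import Summits.HodgeConjecture.CorCM.RealIntersectionCMFieldsHodge
import Literature.AlgebraicGeometry.Pohlmann1968.SimpleCMAbelianVarietyPowersDivisorGenerated
import Literature.AlgebraicGeometry.HodgeTheory.HodgeConjectureIsogenyInvariance
import HarnessLib

/-!
# HODGE GLUING: if `Hg(∏_i A_i) = ∏_i Hg(A_i)`, the Hodge conjecture for the powers of each `A_i` implies the Hodge
# conjecture for EVERY product of copies `∏_j A_{π j}` — degenerate (Weil-type) members allowed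

COR-CM (cell `pub-hodgecm2`, binder seat `b16` gen 60, count-neutral claim HODGE GLUING, file G3 — CM fields and their
realisations; theorems only, no definition, no named fact, no `sorry`).  NEW as stated, hence under `Summits/`.  HONEST
FRAMING: an unconditional REDUCTION between instances of the Hodge conjecture for CM abelian varieties — the Hodge
conjecture for the powers `A_i^{N+1}` of the members is the HYPOTHESIS (for a nondegenerate member it is Pohlmann's
theorem, for a Weil-type fourfold it may be Markman's theorem, …); `HC_CM` is neither used nor asserted.

THE THEOREM (**`hodgeConjectureFor_biproduct_of_cmFamilyRank_add_card_eq`**).  `A_i ⊨ (K_i; Φ_i)` (`i ∈ I` finite)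
realisations of CM types of CM fields forming an ADDITIVE family — `cmFamilyRank Φ + |I| = Σ_i cmTypeRank Φ_i + 1`,
i.e. `dim MT(∏_i A_i) − 1 = Σ_i (dim MT(A_i) − 1)`, `Hg(∏_i A_i) = ∏_i Hg(A_i)`; the members are ARBITRARY.  IF the
Hodge conjecture holds for every power `A_i^{N+1}` of every member, THEN it holds for every product of copies
`⨁_{j ∈ J} A_{π j}` (`π : J → I`, `J` finite non-empty) and for every abelian variety isogenous to one.
PROOF: induction on the number of distinct slots used by `π`; split off the copies of one slot `i₀`:
`⨁_j A_{π j} ≅ A_{i₀}^{a} × ⨁_{π j ≠ i₀} A_{π j}` (`isIsogenous_biproduct_prod_subtype`); the first factor is a power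
(hypothesis), the second has fewer slots (induction), and the Hodge classes of the product are exterior products of Hodge
classes of the two factors because the additive family splits additively along `{i₀} ⊔ rest` and two-block additivity
descends to products of copies (files G1, G2: `hodgeConjectureFor_prod_of_cmFamilyRank_add_card_eq`).

COROLLARIES (§3), the additivity supplied by the tree: **`hodgeConjectureFor_biproduct_of_forall_pointwiseConj_of_powSucc`**
— POINTWISE PARTIAL CONJUGATIONS on every pair of fields (for all `x : K_i → ℂ`, `y : K_j → ℂ` some `σ ∈ Aut(ℂ)` with
`σ ∘ x = x̄`, `σ ∘ y = y`; e.g. the Galois closures of `K_i`, `K_j` meet in a totally real field, or are linearly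
disjoint) ⟹ HC for all `∏_j A_{π j}` from HC for the powers of the members; `…_of_pairwise_separated_of_powSucc` (one
`σ` per ordered pair), `…_of_conj_apply_eq_of_powSucc` (complex conjugation fixes `K_i^{gal} ∩ ∏_{j ≠ i} K_j^{gal}`).
Compared with the tree: `TotallyRealIntersectionCMProductsHodge` / `DisjointCMProductsHodge` glue TWO blocks whose
composita of Galois closures meet in a totally real field; `…_of_forall_pointwiseConj` (this seat, gen 48) needs
NONDEGENERATE members.  Here: any number of members, any types, and the exact rank hypothesis `Hg(∏ A_i) = ∏ Hg(A_i)`.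

## References

* [MoonenZarhin1999LowDim] B. Moonen, Yu. Zarhin, *Hodge classes on abelian varieties of low dimension*, Math. Ann.
  315 (1999), §3 (3.1).
* [Gordon1999HodgeAVSurvey] B. B. Gordon, *A survey of the Hodge conjecture for abelian varieties*, §3 Theorem (Imai,
  Murty) with proof; 7.5–7.7.
* [vanGeemen1994HodgeAV] B. van Geemen, *An introduction to the Hodge conjecture for abelian varieties*, LNM 1594
  (1994), §3.5–3.7 Lemma 3.7.
* [MumfordAV1970] D. Mumford, *Abelian Varieties* (1970), §19.
-/

set_option autoImplicit false

noncomputable section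

open scoped BigOperators

open CategoryTheory CategoryTheory.Limits NumberField IntermediateField

namespace Summit.HodgeConjecture.CorCM

open Literature.NumberTheory.ComplexMultiplication
open Literature.AlgebraicGeometry.Motives (AbelianVariety CMType)
open Literature.AlgebraicGeometry.Motives.AbelianVariety
open Literature.AlgebraicGeometry.HodgeTheory
open Literature.AlgebraicGeometry.ComplexMultiplication (IsCMTypeRealisation)
open Literature.AlgebraicGeometry.Pohlmann1968

/-! ### §1 Two isogenies of bookkeeping -/

section Bookkeeping

/-- **Splitting a finite product along a predicate on the index set**: `⨁_{j ∈ J} C_j` is isogenous (indeed isomorphic)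
to `(⨁_{p j} C_j) × (⨁_{¬p j} C_j)`. [cite: MumfordAV1970, §19] -/
theorem isIsogenous_biproduct_prod_subtype {J : Type} [Fintype J] (C : J → AbelianVariety ℂ) (p : J → Prop)
    [DecidablePred p] :
    IsIsogenous (⨁ C) ((⨁ fun j : {j // p j} => C j.1).prod (⨁ fun j : {j // ¬p j} => C j.1)) := by
  classical
  let f : (⨁ C) ⟶ (⨁ fun j : {j // p j} => C j.1).prod (⨁ fun j : {j // ¬p j} => C j.1) :=
    prodLift (biproduct.lift fun j => biproduct.π C j.1) (biproduct.lift fun j => biproduct.π C j.1)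
  let g : (⨁ fun j : {j // p j} => C j.1).prod (⨁ fun j : {j // ¬p j} => C j.1) ⟶ ⨁ C :=
    biproduct.lift fun j => if h : p j then fst _ _ ≫ biproduct.π (fun j : {j // p j} => C j.1) ⟨j, h⟩
      else snd _ _ ≫ biproduct.π (fun j : {j // ¬p j} => C j.1) ⟨j, h⟩
  have hfg : f ≫ g = 𝟙 _ := by
    refine biproduct.hom_ext _ _ fun j => ?_
    rw [Category.assoc, biproduct.lift_π, Category.id_comp]
    by_cases h : p j
    · rw [dif_pos h, ← Category.assoc, prodLift_fst, biproduct.lift_π]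
    · rw [dif_neg h, ← Category.assoc, prodLift_snd, biproduct.lift_π]
  have hgf : g ≫ f = 𝟙 _ := by
    refine prod_hom_ext ?_ ?_
    · rw [Category.assoc, prodLift_fst, Category.id_comp]
      refine biproduct.hom_ext _ _ fun j => ?_
      rw [Category.assoc, biproduct.lift_π, biproduct.lift_π, dif_pos j.2]
    · rw [Category.assoc, prodLift_snd, Category.id_comp]
      refine biproduct.hom_ext _ _ fun j => ?_
      rw [Category.assoc, biproduct.lift_π, biproduct.lift_π, dif_neg j.2]
  exact ⟨f, isIsogeny_hom_of_iso ⟨f, g, hfg, hgf⟩⟩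

/-- **The Hodge conjecture for all powers `B^{N+1}` gives it for every product of copies `⨁_{j ∈ J} B`** (`J` finite
non-empty; `B^{|J|} ≅ ⨁_{Fin |J|} B ≅ ⨁_J B`). [cite: vanGeemen1994HodgeAV, §3.5–3.7 Lemma 3.7 (p. 236)]
[cite: MumfordAV1970, §19] -/
theorem hodgeConjectureFor_biproduct_const_of_powSucc {B : AbelianVariety ℂ}
    (hHC : ∀ N : ℕ, HodgeConjectureFor (B.powSucc N).dim (B.powSucc N).X) {J : Type} [Fintype J] [Nonempty J] :
    HodgeConjectureFor (⨁ fun _ : J => B).dim (⨁ fun _ : J => B).X := by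
  classical
  have hJ : Fintype.card J = (Fintype.card J - 1) + 1 := (Nat.succ_pred_eq_of_pos Fintype.card_pos).symm
  let e : Fin (Fintype.card J - 1 + 1) ≃ J := (Fintype.equivFinOfCardEq hJ).symm
  have h1 : HodgeConjectureFor (⨁ fun _ : Fin (Fintype.card J - 1 + 1) => B).dim
      (⨁ fun _ : Fin (Fintype.card J - 1 + 1) => B).X :=
    HodgeConjectureFor.of_isIsogenous' (isIsogenous_powSucc_biproduct B (Fintype.card J - 1)) (hHC _)
  exact HodgeConjectureFor.of_isIsogenous'
    ⟨(biproduct.reindex e fun _ : J => B).hom, isIsogeny_hom_of_iso (biproduct.reindex e fun _ : J => B)⟩ h1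

end Bookkeeping

/-! ### §2 The gluing theorem -/

section Gluing

variable {I : Type} [Fintype I] {K : I → Type} [∀ i, Field (K i)] [∀ i, NumberField (K i)] [∀ i, IsCMField (K i)]
  {Φ : ∀ i, CMType (K i)} {A : I → AbelianVariety ℂ} {ιA : ∀ i, 𝓞 (K i) →+* End (A i)}
  {θ : ∀ i, K i →+* Module.End ℂ (complexBetti (A i).X 1)}

/-- **HODGE GLUING ALONG AN ADDITIVE FAMILY.**  `A_i ⊨ (K_i; Φ_i)` realisations of CM types of CM fields (`i ∈ I`
finite) with `cmFamilyRank Φ + |I| = Σ_i cmTypeRank Φ_i + 1` (`Hg(∏_i A_i) = ∏_i Hg(A_i)`; the types are arbitrary).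
If the Hodge conjecture holds for every power `A_i^{N+1}` of every member, then it holds for EVERY product of copies
`⨁_{j ∈ J} A_{π j}` (`π : J → I`, `J` finite non-empty).  Induction on the number of slots used: split off the copies of
one slot (a power: hypothesis), the rest has fewer slots, and the two factors glue because the family splits additively
along `{i₀} ⊔ rest` (`hodgeConjectureFor_prod_of_cmFamilyRank_add_card_eq`).
[cite: MoonenZarhin1999LowDim, §3 (3.1)] [cite: Gordon1999HodgeAVSurvey, §3 Theorem (Imai, Murty) with proof, 7.5–7.7]
[cite: vanGeemen1994HodgeAV, §3.5–3.7 Lemma 3.7 (p. 236)] -/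
theorem hodgeConjectureFor_biproduct_of_cmFamilyRank_add_card_eq
    (hadd : CMAlgebra.cmFamilyRank Φ + Fintype.card I = (∑ i, cmTypeRank (Φ i)) + 1)
    (hA : ∀ i, IsCMTypeRealisation (Φ i) (A i) (ιA i) (θ i))
    (hHC : ∀ (i : I) (N : ℕ), HodgeConjectureFor ((A i).powSucc N).dim ((A i).powSucc N).X)
    {J : Type} [Fintype J] [Nonempty J] (π : J → I) :
    HodgeConjectureFor (⨁ fun j => A (π j)).dim (⨁ fun j => A (π j)).X := by
  classical
  -- induction on the number of slots used by `π`
  suffices key : ∀ (n : ℕ) {J : Type} [Fintype J] [Nonempty J] (π : J → I),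
      (Finset.univ.image π).card ≤ n → HodgeConjectureFor (⨁ fun j => A (π j)).dim (⨁ fun j => A (π j)).X from
    key _ π le_rfl
  intro n
  induction n with
  | zero =>
    intro J _ _ π hcard
    obtain ⟨j₀⟩ := ‹Nonempty J›
    exact absurd (Finset.card_pos.2 ⟨π j₀, Finset.mem_image_of_mem π (Finset.mem_univ j₀)⟩) (by omega)
  | succ n ih =>
    intro J _ _ π hcard
    obtain ⟨j₀⟩ := ‹Nonempty J›
    by_cases hall : ∀ j, π j = π j₀
    · -- only one slot: a product of copies of `A (π j₀)`
      have hfun : (fun j => A (π j)) = fun _ : J => A (π j₀) := funext fun j => by rw [hall j]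
      rw [hfun]
      exact hodgeConjectureFor_biproduct_const_of_powSucc (hHC (π j₀))
    · push Not at hall
      obtain ⟨j₁, hj₁⟩ := hall
      let p : J → Prop := fun j => π j = π j₀
      haveI : Nonempty {j // p j} := ⟨⟨j₀, rfl⟩⟩
      haveI : Nonempty {j // ¬p j} := ⟨⟨j₁, hj₁⟩⟩
      -- the copies of `A (π j₀)`
      have hX : HodgeConjectureFor (⨁ fun j : {j // p j} => A (π j.1)).dim (⨁ fun j : {j // p j} => A (π j.1)).X := by
        have hfun : (fun j : {j // p j} => A (π j.1)) = fun _ : {j // p j} => A (π j₀) :=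
          funext fun j => by rw [show π j.1 = π j₀ from j.2]
        rw [hfun]
        exact hodgeConjectureFor_biproduct_const_of_powSucc (hHC (π j₀))
      -- the other slots: fewer of them
      have hY : HodgeConjectureFor (⨁ fun j : {j // ¬p j} => A (π j.1)).dim
          (⨁ fun j : {j // ¬p j} => A (π j.1)).X := by
        refine ih (fun j : {j // ¬p j} => π j.1) ?_
        have hsub : Finset.univ.image (fun j : {j // ¬p j} => π j.1) ⊆ (Finset.univ.image π).erase (π j₀) := by
          intro i hi
          obtain ⟨j, -, rfl⟩ := Finset.mem_image.1 hi
          exact Finset.mem_erase.2 ⟨j.2, Finset.mem_image_of_mem π (Finset.mem_univ j.1)⟩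
        have h0 : π j₀ ∈ Finset.univ.image π := Finset.mem_image_of_mem π (Finset.mem_univ j₀)
        have h1 := Finset.card_le_card hsub
        rw [Finset.card_erase_of_mem h0] at h1
        omega
      -- glue
      have hprod := hodgeConjectureFor_prod_of_cmFamilyRank_add_card_eq hadd hA (fun j : {j // p j} => π j.1)
        (fun j : {j // ¬p j} => π j.1) (fun j₁ j₂ h => j₂.2 (h.symm.trans j₁.2)) (IsIsogenous.refl _)
        (IsIsogenous.refl _) hX hY
      exact HodgeConjectureFor.of_isIsogenous (isIsogenous_biproduct_prod_subtype (fun j => A (π j)) p) hprod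

/-- **Isogenous carriers**: under the same hypotheses, the Hodge conjecture holds for every abelian variety isogenous to
a product of copies `⨁_j A_{π j}` (e.g. `∏_i A_i^{k_i}` in any bracketing). [cite: vanGeemen1994HodgeAV, §3.5–3.7 Lemma 3.7 (p. 236)]
[cite: MoonenZarhin1999LowDim, §3 (3.1)] -/
theorem hodgeConjectureFor_of_isIsogenous_biproduct_of_cmFamilyRank_add_card_eq
    (hadd : CMAlgebra.cmFamilyRank Φ + Fintype.card I = (∑ i, cmTypeRank (Φ i)) + 1)
    (hA : ∀ i, IsCMTypeRealisation (Φ i) (A i) (ιA i) (θ i))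
    (hHC : ∀ (i : I) (N : ℕ), HodgeConjectureFor ((A i).powSucc N).dim ((A i).powSucc N).X)
    {J : Type} [Fintype J] [Nonempty J] (π : J → I) {X : AbelianVariety ℂ}
    (hX : IsIsogenous X (⨁ fun j => A (π j))) : HodgeConjectureFor X.dim X.X :=
  HodgeConjectureFor.of_isIsogenous hX (hodgeConjectureFor_biproduct_of_cmFamilyRank_add_card_eq hadd hA hHC π)

/-- **The full product**: additivity + HC for the powers of the members ⟹ HC for `∏_i A_i` itself.
[cite: MoonenZarhin1999LowDim, §3 (3.1)] -/
theorem hodgeConjectureFor_biproduct_univ_of_cmFamilyRank_add_card_eq [Nonempty I]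
    (hadd : CMAlgebra.cmFamilyRank Φ + Fintype.card I = (∑ i, cmTypeRank (Φ i)) + 1)
    (hA : ∀ i, IsCMTypeRealisation (Φ i) (A i) (ιA i) (θ i))
    (hHC : ∀ (i : I) (N : ℕ), HodgeConjectureFor ((A i).powSucc N).dim ((A i).powSucc N).X) :
    HodgeConjectureFor (⨁ A).dim (⨁ A).X :=
  hodgeConjectureFor_biproduct_of_cmFamilyRank_add_card_eq hadd hA hHC id

end Gluing

/-! ### §3 Named Galois hypotheses supplying the additivity -/

section Named

variable {I : Type} [Fintype I] [DecidableEq I] {K : I → Type} [∀ i, Field (K i)] [∀ i, NumberField (K i)]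
  [∀ i, IsCMField (K i)] {Φ : ∀ i, CMType (K i)} {A : I → AbelianVariety ℂ} {ιA : ∀ i, 𝓞 (K i) →+* End (A i)}
  {θ : ∀ i, K i →+* Module.End ℂ (complexBetti (A i).X 1)}

/-- **HODGE GLUING UNDER POINTWISE PARTIAL CONJUGATIONS.**  CM fields `K_i` such that for all `i ≠ j` and every pair of
embeddings `x : K_i → ℂ`, `y : K_j → ℂ` some automorphism `σ` of `ℂ` has `σ ∘ x = x̄` and `σ ∘ y = y` (e.g. the Galois
closures of `K_i` and `K_j` meet in a totally real field; or are linearly disjoint); ARBITRARY CM types `Φ_i` and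
realisations `A_i`.  If the Hodge conjecture holds for all powers of every `A_i`, it holds for every product of copies
`⨁_j A_{π j}`. [cite: Gordon1999HodgeAVSurvey, §3 Theorem (Imai, Murty) with proof, 7.5–7.7] [cite: MoonenZarhin1999LowDim, §3 (3.1)] -/
theorem hodgeConjectureFor_biproduct_of_forall_pointwiseConj_of_powSucc
    (hpt : ∀ i j, i ≠ j → ∀ (x : K i →+* ℂ) (y : K j →+* ℂ),
      ∃ σ : ℂ ≃+* ℂ, σ • x = (starRingAut : ℂ ≃+* ℂ) • x ∧ σ • y = y)
    (hA : ∀ i, IsCMTypeRealisation (Φ i) (A i) (ιA i) (θ i))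
    (hHC : ∀ (i : I) (N : ℕ), HodgeConjectureFor ((A i).powSucc N).dim ((A i).powSucc N).X)
    {J : Type} [Fintype J] [Nonempty J] (π : J → I) :
    HodgeConjectureFor (⨁ fun j => A (π j)).dim (⨁ fun j => A (π j)).X := by
  obtain ⟨j₀⟩ := ‹Nonempty J›
  haveI : Nonempty I := ⟨π j₀⟩
  exact hodgeConjectureFor_biproduct_of_cmFamilyRank_add_card_eq (cmFamilyRank_add_card_eq_of_forall_pointwiseConj Φ hpt)
    hA hHC π

/-- **Hodge gluing for pairwise conjugation-separated fields**: for all `i ≠ j` ONE automorphism of `ℂ` is complex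
conjugation on every embedding of `K_i` and the identity on every embedding of `K_j` (the hypothesis of
`IrreducibleOddWeightsSeparatedSlots`; it implies the pointwise one). [cite: Gordon1999HodgeAVSurvey, §3 Theorem (Imai, Murty) with proof] -/
theorem hodgeConjectureFor_biproduct_of_pairwise_separated_of_powSucc
    (hsep : ∀ i j : I, i ≠ j → ∃ τ : ℂ ≃+* ℂ,
      (∀ s : K i →+* ℂ, τ • s = (starRingAut : ℂ ≃+* ℂ) • s) ∧ ∀ s : K j →+* ℂ, τ • s = s)
    (hA : ∀ i, IsCMTypeRealisation (Φ i) (A i) (ιA i) (θ i))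
    (hHC : ∀ (i : I) (N : ℕ), HodgeConjectureFor ((A i).powSucc N).dim ((A i).powSucc N).X)
    {J : Type} [Fintype J] [Nonempty J] (π : J → I) :
    HodgeConjectureFor (⨁ fun j => A (π j)).dim (⨁ fun j => A (π j)).X := by
  refine hodgeConjectureFor_biproduct_of_forall_pointwiseConj_of_powSucc (fun i j hij x y => ?_) hA hHC π
  obtain ⟨τ, hτi, hτj⟩ := hsep i j hij
  exact ⟨τ, hτi x, hτj y⟩

omit [DecidableEq I] in
/-- **Hodge gluing for CM fields whose Galois closures meet in totally real fields** (field form): if complex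
conjugation fixes `K_i^{gal} ∩ ∏_{j ≠ i} K_j^{gal}` pointwise for every `i` (Galois closures taken in `ℂ`), then for
arbitrary CM types the Hodge conjecture for the powers of the members gives it for every `⨁_j A_{π j}`.
[cite: Gordon1999HodgeAVSurvey, §3 Theorem (Imai, Murty) with proof] [cite: MoonenZarhin1999LowDim, §3 (3.1)] -/
theorem hodgeConjectureFor_biproduct_of_conj_apply_eq_of_powSucc
    (hreal : ∀ (i : I) (x : ℂ), x ∈ normalClosure ℚ (K i) ℂ →
      x ∈ (⨆ j : {j : I // j ≠ i}, normalClosure ℚ (K j.1) ℂ) → starRingEnd ℂ x = x)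
    (hA : ∀ i, IsCMTypeRealisation (Φ i) (A i) (ιA i) (θ i))
    (hHC : ∀ (i : I) (N : ℕ), HodgeConjectureFor ((A i).powSucc N).dim ((A i).powSucc N).X)
    {J : Type} [Fintype J] [Nonempty J] (π : J → I) :
    HodgeConjectureFor (⨁ fun j => A (π j)).dim (⨁ fun j => A (π j)).X := by
  obtain ⟨j₀⟩ := ‹Nonempty J›
  haveI : Nonempty I := ⟨π j₀⟩
  exact hodgeConjectureFor_biproduct_of_cmFamilyRank_add_card_eq (cmFamilyRank_add_card_eq_of_conj_apply_eq hreal Φ)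
    hA hHC π

end Named

end Summit.HodgeConjecture.CorCM

end
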